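import Summits.QuantumFields.BalabanUV.T4Continuum.Support.NE7EtaCovariantJunction

/-!
# NE7EtaRatesD4Cov — route #1 of the NE7 crux, hardest stub S1∕L7b-background: the four geometric rates of `NE7EtaRatesD4` at `d = 4`
# re-derived from GAUGE-COVARIANT Lipschitz hypotheses (Lip₁ᶜ)(Lip₂ᶜ)(Lip₂′ᶜ), with the GRADIENT coordinate now the COVARIANT one of (1.13),
# and threaded through row NE3's root T-E_w — the gauge-invariant form of the INTERFACE REQUEST NE7→NE3

Cell `pub-balaban`, rung (B)+1 sub-cell t4, lineage `b2b-balaban-t4-ne7-p1`, generation 22 (CRUX PROVER NE7 #1, ruling e34b3e0c); crux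
skeleton `t4/skeletons/NE7-CRUX-R1.md` v1.6 §3ter.  Sequel of `NE7EtaRatesD4` (p251795), `NE7EtaRatesD4Root` (p252219),
`NE7EtaCovariantJunction`.  HONEST FRAMING (page 1): FIXED FINITE T⁴, rung (B)+1; NE7, NE3 NOT PRINTED in
[Balaban1984PropagatorsI]–[Balaban1989LargeFieldII] and NOT PROVED here; continuum YM on T⁴ ⇐ BetaPertH ∧ nine spine estimates (0/9 proved);
BetaPertH ⇐ (D1) ∧ (D4) ∧ CAP+tail; G-an2-4 gates asym, D1 and NE2/3/4; NOT infinite volume, NOT mass gap, NOT Clay.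

WHAT.  `θ⁶ = L⁻¹`, `ξ = (L⁻¹)^k`; ONE `N L^k`-periodic pair `(W, Z)` on `ℤ⁴`, `W` UNITARY; (E) `L^k·energyNormW ≤ γ³`; FIT `γθ^{2k} ≤ l·N`;
and the COVARIANT Lipschitz data (all invariant under `(W, Z) ↦ (gaugeAct w W, Ad (w (· + e ·)) Z)`):
  (Lip₁ᶜ)  `‖Ad (W (x + e κ) μ) (Z (x + e μ) κ) − Z x κ‖ ≤ Λ₁ξ²`, `Λ₁ ≤ l₁³`;
  (Lip₂ᶜ)  `‖Ad (W x ρ) (d_W Z)(x + e ρ, π) − (d_W Z)(x, π)‖ ≤ Λ₂ξ³`, `Λ₂ ≤ l₂³`;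
  (Lip₂′ᶜ) `‖Ad (W (y + e κ) μ) (Ad (W (y + e κ + e μ) μ) (Z (y + 2•e μ) κ) − Z (y + e μ) κ) − (Ad (W (y + e κ) μ) (Z (y + e μ) κ) − Z y κ)‖ ≤ Λ₂′ξ³`,
           `Λ₂′ > 0`.
Then: **`norm_dir_le_rate_cov`** `‖Z x κ‖ ≤ 8l₁²γ·θ^{8k}`; **`norm_curl_le_rate_cov`** `‖d_W Z (x, π)‖ ≤ 8l₂²γ·θ^{14k}`;
**`norm_covDiff_le_rate`** `‖Ad (W (x + e κ) μ) (Z (x + e μ) κ) − Z x κ‖ ≤ 4l₁√(2γΛ₂′)·θ^{13k}` (the COVARIANT gradient `∇^ξ_W a` of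
[Balaban1987RG1] p. 262 (1.13), field units `≲ θ^{k}`); **`norm_hol_sub_le_rate_cov`** `‖(W e^Z)(∂p) − W(∂p)‖ ≤ (8l₂²γ + 1536l₁⁴γ²e^{8l₁²γ})·θ^{14k}`;
and **`closeness_rates_cov_of_ne3EnergyRateW`** = all four through T-E_w (`NE3EnergyRateW`) with the covariant antecedents on the produced
`Z` — THE GAUGE-INVARIANT FORM OF THE ASK: every hypothesis and every conclusion is unchanged under a re-gauging of run B's `W` (with run A's
`u` composed accordingly), so row NE3 may establish its root in whatever gauge of `W` is convenient (e.g. a local regular gauge of (1.12)).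
HONEST.  Bookkeeping over `NE7EtaCovariantJunction` + `NE7EtaRatesD4` ([folklore]); hypotheses on ONE pair; nothing of NE3∕NE7 discharged;
NODE O untouched; 0 def; 0 sorry; nothing printed is a hypothesis of a theorem.
-/

set_option autoImplicit false

open scoped BigOperators Matrix Matrix.Norms.L2Operator
open Finset

namespace Summit.QuantumFields.BalabanUV.T4Continuum.NE7EtaRatesD4Cov

open Literature.MathematicalPhysics.QuantumFieldTheory.Balaban1983to89
open B7Prop1Explicit B7Prop2Explicit
open T4AveragingDeficitWall hiding Site Plane Plaq Bond
open T4AveragingDeficitWallBoundary (periodBox IsPeriodicCfg)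
open AveragingDeficitPeriodicCounting (IsPeriodicDir)
open MinimalActionSandwich (IsMinimiser)
open MinimalActionRate (Regular)
open NE3EnergyShapes (residualScale residualScale_nonneg IsUnitarySite IsPeriodicSite)
open NE3EnergyWeightedShapes (energyNormW energyNormW_nonneg NE3EnergyRateW)
open NE3HessContinuity (bondL1At bondL1At_nonneg)
open NE3EnergySmallFieldCurl (norm_hol_vary_sub_hol_le_curl)
open AveragingDeficitDualResidual (dualC1 dualC2)
open AveragingDeficitDerivWallProof (wallConst)
open NE7EtaPlaquetteClosenessTorus (le_opt_of_two_term)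
open NE7EtaRatesD4 (scale_eq scale_le_half fit_cube energy_budget_of_residualScale)
open NE7EtaCovariantJunction (abs_norm_sub_norm_le_cov norm_dir_le_of_energyNormW_normLip_periodic
  norm_curl_le_of_energyNormW_normLip_periodic norm_covDiff_le_two_sqrt)

noncomputable section

variable {n : Type*} [Fintype n] [DecidableEq n]

/-! ## §1 The four coordinates from covariant Lipschitz data -/

/-- **POTENTIAL COORDINATE FROM (Lip₁ᶜ)** (`W` unitary; (E), FIT with `l₁`): `‖Z x κ‖ ≤ 8l₁²γ·θ^{8k}` everywhere. [folklore] -/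
theorem norm_dir_le_rate_cov {L N k : ℕ} (hL : 2 ≤ L) (hN : 1 ≤ N) (hk : 1 ≤ k) {θ : ℝ} (hθ : 0 < θ)
    (hθ6 : θ ^ 6 = ((L : ℝ))⁻¹) {W : Site 4 → Fin 4 → (Matrix n n ℂ)ˣ} {Z : Site 4 → Fin 4 → Matrix n n ℂ}
    (hWu : IsUnitaryCfg W) (hWP : IsPeriodicCfg W ((N * L ^ k : ℕ) : ℤ)) (hZP : IsPeriodicDir Z ((N * L ^ k : ℕ) : ℤ))
    {γ Λ₁ l₁ : ℝ} (hγ : 0 < γ) (hl₁ : 0 < l₁) (hΛl : Λ₁ ≤ l₁ ^ 3)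
    (hE : (L : ℝ) ^ k * energyNormW L k W Z (periodBox (d := 4) (N * L ^ k)) ≤ γ ^ 3)
    (hlipc : ∀ (κ : Fin 4) (x : Site 4) (μ : Fin 4), ‖Ad (W (x + e κ) μ) (Z (x + e μ) κ) - Z x κ‖ ≤ Λ₁ * (((L : ℝ)⁻¹) ^ k) ^ 2)
    (hfit : γ * (θ ^ k) ^ 2 ≤ l₁ * N) (x : Site 4) (κ : Fin 4) :
    ‖Z x κ‖ ≤ 8 * l₁ ^ 2 * γ * θ ^ (8 * k) := by
  have hL1 : 1 ≤ L := by omega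
  obtain ⟨hξ, hLs⟩ := scale_eq hL1 hθ6 k
  obtain ⟨hhalf, -⟩ := scale_le_half hL hθ hθ6 hk
  set s : ℝ := θ ^ k with hsdef
  have hs : 0 < s := pow_pos hθ k
  set P : ℕ := N * L ^ k with hPdef
  have hP : 1 ≤ P := Nat.one_le_iff_ne_zero.mpr (Nat.mul_ne_zero (by omega) (pow_ne_zero k (by omega)))
  set E := energyNormW L k W Z (periodBox (d := 4) P) with hEdef
  -- covariant ⇒ norm-Lipschitz
  have hlipn : ∀ (y : Site 4) (μ : Fin 4), |‖Z (y + e μ) κ‖ - ‖Z y κ‖| ≤ Λ₁ * (((L : ℝ)⁻¹) ^ k) ^ 2 := fun y μ =>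
    (abs_norm_sub_norm_le_cov (hWu (y + e κ) μ) _ _).trans (hlipc κ y μ)
  have hlam : 0 ≤ Λ₁ * (((L : ℝ)⁻¹) ^ k) ^ 2 := (abs_nonneg _).trans (hlipn x 0)
  have ha : 0 < 2 * l₁ * s ^ 4 := by positivity
  have ha3 : 8 * (Λ₁ * (((L : ℝ)⁻¹) ^ k) ^ 2) ≤ (2 * l₁ * s ^ 4) ^ 3 := by
    rw [hξ]
    have : Λ₁ * (s ^ 6) ^ 2 ≤ l₁ ^ 3 * (s ^ 6) ^ 2 := mul_le_mul_of_nonneg_right hΛl (by positivity)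
    nlinarith
  have hfit' : γ / (2 * l₁ * s ^ 4) + 1 ≤ ((N * L ^ k : ℕ) : ℝ) := fit_cube hN hs hl₁ hLs hhalf hfit
  have h := le_opt_of_two_term (v := ‖Z x κ‖) (B := (L : ℝ) ^ k * E) ha hγ ha3 hE hfit' fun r hr => by
    have h' := norm_dir_le_of_energyNormW_normLip_periodic hL1 k hP hWP hZP κ hlam hlipn x hr
    push_cast at h'
    linarith
  have e8 : θ ^ (8 * k) = s ^ 8 := by rw [hsdef, ← pow_mul, mul_comm k 8]
  calc ‖Z x κ‖ ≤ 2 * (2 * l₁ * s ^ 4) ^ 2 * γ := h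
    _ = 8 * l₁ ^ 2 * γ * θ ^ (8 * k) := by rw [e8]; ring

/-- **CURL COORDINATE FROM (Lip₂ᶜ)** on the plane `π` (`W` unitary; (E), FIT with `l₂`): `‖d_W Z (x, π)‖ ≤ 8l₂²γ·θ^{14k}`. [folklore] -/
theorem norm_curl_le_rate_cov {L N k : ℕ} (hL : 2 ≤ L) (hN : 1 ≤ N) (hk : 1 ≤ k) {θ : ℝ} (hθ : 0 < θ)
    (hθ6 : θ ^ 6 = ((L : ℝ))⁻¹) {W : Site 4 → Fin 4 → (Matrix n n ℂ)ˣ} {Z : Site 4 → Fin 4 → Matrix n n ℂ}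
    (hWu : IsUnitaryCfg W) (hWP : IsPeriodicCfg W ((N * L ^ k : ℕ) : ℤ)) (hZP : IsPeriodicDir Z ((N * L ^ k : ℕ) : ℤ))
    {γ Λ₂ l₂ : ℝ} (hγ : 0 < γ) (hl₂ : 0 < l₂) (hΛl : Λ₂ ≤ l₂ ^ 3)
    (hE : (L : ℝ) ^ k * energyNormW L k W Z (periodBox (d := 4) (N * L ^ k)) ≤ γ ^ 3)
    (π : T4AveragingDeficitWall.Plane 4)
    (hlipc : ∀ (x : Site 4) (ρ : Fin 4), ‖Ad (W x ρ) (curl W Z (x + e ρ, π)) - curl W Z (x, π)‖ ≤ Λ₂ * (((L : ℝ)⁻¹) ^ k) ^ 3)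
    (hfit : γ * (θ ^ k) ^ 2 ≤ l₂ * N) (x : Site 4) :
    ‖curl W Z (x, π)‖ ≤ 8 * l₂ ^ 2 * γ * θ ^ (14 * k) := by
  have hL1 : 1 ≤ L := by omega
  obtain ⟨hξ, hLs⟩ := scale_eq hL1 hθ6 k
  obtain ⟨hhalf, -⟩ := scale_le_half hL hθ hθ6 hk
  set s : ℝ := θ ^ k with hsdef
  have hs : 0 < s := pow_pos hθ k
  set P : ℕ := N * L ^ k with hPdef
  have hP : 1 ≤ P := Nat.one_le_iff_ne_zero.mpr (Nat.mul_ne_zero (by omega) (pow_ne_zero k (by omega)))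
  set E := energyNormW L k W Z (periodBox (d := 4) P) with hEdef
  have hlipn : ∀ (y : Site 4) (ρ : Fin 4), |‖curl W Z (y + e ρ, π)‖ - ‖curl W Z (y, π)‖| ≤ Λ₂ * (((L : ℝ)⁻¹) ^ k) ^ 3 :=
    fun y ρ => (abs_norm_sub_norm_le_cov (hWu y ρ) _ _).trans (hlipc y ρ)
  have hlam : 0 ≤ Λ₂ * (((L : ℝ)⁻¹) ^ k) ^ 3 := (abs_nonneg _).trans (hlipn x 0)
  have hEs : E ≤ (γ * s ^ 2) ^ 3 := by
    have : E = s ^ 6 * ((L : ℝ) ^ k * E) := by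
      rw [← mul_assoc, mul_comm (s ^ 6), hLs, one_mul]
    rw [this]
    calc s ^ 6 * ((L : ℝ) ^ k * E) ≤ s ^ 6 * γ ^ 3 := mul_le_mul_of_nonneg_left hE (by positivity)
      _ = (γ * s ^ 2) ^ 3 := by ring
  have ha : 0 < 2 * l₂ * s ^ 6 := by positivity
  have hb : 0 < γ * s ^ 2 := by positivity
  have ha3 : 8 * (Λ₂ * (((L : ℝ)⁻¹) ^ k) ^ 3) ≤ (2 * l₂ * s ^ 6) ^ 3 := by
    rw [hξ]
    have : Λ₂ * (s ^ 6) ^ 3 ≤ l₂ ^ 3 * (s ^ 6) ^ 3 := mul_le_mul_of_nonneg_right hΛl (by positivity)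
    nlinarith
  have hfit' : γ * s ^ 2 / (2 * l₂ * s ^ 6) + 1 ≤ ((N * L ^ k : ℕ) : ℝ) := by
    have e1 : γ * s ^ 2 / (2 * l₂ * s ^ 6) = γ / (2 * l₂ * s ^ 4) := by
      field_simp
    rw [e1]
    exact fit_cube hN hs hl₂ hLs hhalf hfit
  have h := le_opt_of_two_term (v := ‖curl W Z (x, π)‖) (B := E) ha hb ha3 hEs hfit' fun r hr => by
    have h' := norm_curl_le_of_energyNormW_normLip_periodic L k hP hWP hZP π hlam hlipn x hr
    push_cast at h'
    linarith
  have e14 : θ ^ (14 * k) = s ^ 14 := by rw [hsdef, ← pow_mul, mul_comm k 14]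
  calc ‖curl W Z (x, π)‖ ≤ 2 * (2 * l₂ * s ^ 6) ^ 2 * (γ * s ^ 2) := h
    _ = 8 * l₂ ^ 2 * γ * θ ^ (14 * k) := by rw [e14]; ring

/-- **THE COVARIANT GRADIENT COORDINATE AT RATE `θ^{13k}`** (`W` unitary; (E), (Lip₁ᶜ), (Lip₂′ᶜ) `Λ₂′ > 0`, FIT with `l₁`):
`‖Ad (W (x + e κ) μ) (Z (x + e μ) κ) − Z x κ‖ ≤ 4l₁√(2γΛ₂′)·θ^{13k}` — the covariant lattice gradient of the discrepancy potential, the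
object of (1.13), is `≲ θ^{k}` in field units (margin `ξ² = θ^{12k}`). [folklore] -/
theorem norm_covDiff_le_rate {L N k : ℕ} (hL : 2 ≤ L) (hN : 1 ≤ N) (hk : 1 ≤ k) {θ : ℝ} (hθ : 0 < θ)
    (hθ6 : θ ^ 6 = ((L : ℝ))⁻¹) {W : Site 4 → Fin 4 → (Matrix n n ℂ)ˣ} {Z : Site 4 → Fin 4 → Matrix n n ℂ}
    (hWu : IsUnitaryCfg W) (hWP : IsPeriodicCfg W ((N * L ^ k : ℕ) : ℤ)) (hZP : IsPeriodicDir Z ((N * L ^ k : ℕ) : ℤ))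
    {γ Λ₁ l₁ Λ₂' : ℝ} (hγ : 0 < γ) (hl₁ : 0 < l₁) (hΛl : Λ₁ ≤ l₁ ^ 3) (hΛ₂' : 0 < Λ₂')
    (hE : (L : ℝ) ^ k * energyNormW L k W Z (periodBox (d := 4) (N * L ^ k)) ≤ γ ^ 3)
    (hlipc : ∀ (κ : Fin 4) (x : Site 4) (μ : Fin 4), ‖Ad (W (x + e κ) μ) (Z (x + e μ) κ) - Z x κ‖ ≤ Λ₁ * (((L : ℝ)⁻¹) ^ k) ^ 2)
    (hlip2c : ∀ (κ μ : Fin 4) (y : Site 4),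
      ‖Ad (W (y + e κ) μ) (Ad (W (y + e κ + e μ) μ) (Z (y + (2 : ℕ) • e μ) κ) - Z (y + e μ) κ)
        - (Ad (W (y + e κ) μ) (Z (y + e μ) κ) - Z y κ)‖ ≤ Λ₂' * (((L : ℝ)⁻¹) ^ k) ^ 3)
    (hfit : γ * (θ ^ k) ^ 2 ≤ l₁ * N) (x : Site 4) (μ κ : Fin 4) :
    ‖Ad (W (x + e κ) μ) (Z (x + e μ) κ) - Z x κ‖ ≤ 4 * l₁ * Real.sqrt (2 * γ * Λ₂') * θ ^ (13 * k) := by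
  have hL1 : 1 ≤ L := by omega
  obtain ⟨hξ, -⟩ := scale_eq hL1 hθ6 k
  set s : ℝ := θ ^ k with hsdef
  have hs : 0 < s := pow_pos hθ k
  have hsup : ∀ y, ‖Z y κ‖ ≤ 8 * l₁ ^ 2 * γ * θ ^ (8 * k) := fun y =>
    norm_dir_le_rate_cov hL hN hk hθ hθ6 hWu hWP hZP hγ hl₁ hΛl hE hlipc hfit y κ
  have hM0 : 0 < 8 * l₁ ^ 2 * γ * θ ^ (8 * k) := by positivity
  have hl2 : 0 < Λ₂' * (((L : ℝ)⁻¹) ^ k) ^ 3 := by rw [hξ]; positivity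
  have h := norm_covDiff_le_two_sqrt hWu κ μ hM0 hl2 hsup (hlip2c κ μ) x
  have e8 : θ ^ (8 * k) = s ^ 8 := by rw [hsdef, ← pow_mul, mul_comm k 8]
  have e13 : θ ^ (13 * k) = s ^ 13 := by rw [hsdef, ← pow_mul, mul_comm k 13]
  have hsq : Real.sqrt (8 * l₁ ^ 2 * γ * θ ^ (8 * k) * (Λ₂' * (((L : ℝ)⁻¹) ^ k) ^ 3))
      = 2 * l₁ * s ^ 13 * Real.sqrt (2 * γ * Λ₂') := by
    rw [e8, hξ]
    have e1 : 8 * l₁ ^ 2 * γ * s ^ 8 * (Λ₂' * (s ^ 6) ^ 3) = (2 * l₁ * s ^ 13) ^ 2 * (2 * γ * Λ₂') := by ring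
    rw [e1, Real.sqrt_mul (sq_nonneg _), Real.sqrt_sq (by positivity)]
  calc ‖Ad (W (x + e κ) μ) (Z (x + e μ) κ) - Z x κ‖
      ≤ 2 * Real.sqrt (8 * l₁ ^ 2 * γ * θ ^ (8 * k) * (Λ₂' * (((L : ℝ)⁻¹) ^ k) ^ 3)) := h
    _ = 4 * l₁ * Real.sqrt (2 * γ * Λ₂') * θ ^ (13 * k) := by rw [hsq, e13]; ring

/-- **PLAQUETTE COORDINATE FROM (Lip₁ᶜ)(Lip₂ᶜ)** (`W` unitary, `Z` skew; (E), both FITs):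
`‖(W e^Z)(∂p) − W(∂p)‖ ≤ (8l₂²γ + 1536l₁⁴γ²e^{8l₁²γ})·θ^{14k}` at `p = (z; μ < ν)`. [folklore] -/
theorem norm_hol_sub_le_rate_cov [Nonempty n] {L N k : ℕ} (hL : 2 ≤ L) (hN : 1 ≤ N) (hk : 1 ≤ k) {θ : ℝ} (hθ : 0 < θ)
    (hθ6 : θ ^ 6 = ((L : ℝ))⁻¹) {W : Site 4 → Fin 4 → (Matrix n n ℂ)ˣ} {Z : Site 4 → Fin 4 → Matrix n n ℂ}
    (hWu : IsUnitaryCfg W) (hZs : IsSkewDir Z) (hWP : IsPeriodicCfg W ((N * L ^ k : ℕ) : ℤ))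
    (hZP : IsPeriodicDir Z ((N * L ^ k : ℕ) : ℤ)) {γ Λ₁ l₁ Λ₂ l₂ : ℝ} (hγ : 0 < γ) (hl₁ : 0 < l₁) (hΛl₁ : Λ₁ ≤ l₁ ^ 3)
    (hl₂ : 0 < l₂) (hΛl₂ : Λ₂ ≤ l₂ ^ 3)
    (hE : (L : ℝ) ^ k * energyNormW L k W Z (periodBox (d := 4) (N * L ^ k)) ≤ γ ^ 3)
    (hlipc : ∀ (κ : Fin 4) (x : Site 4) (μ : Fin 4), ‖Ad (W (x + e κ) μ) (Z (x + e μ) κ) - Z x κ‖ ≤ Λ₁ * (((L : ℝ)⁻¹) ^ k) ^ 2)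
    (z : Site 4) {μ ν : Fin 4} (hμν : μ < ν)
    (hlipc' : ∀ (x : Site 4) (ρ : Fin 4),
      ‖Ad (W x ρ) (curl W Z (x + e ρ, ⟨(μ, ν), hμν⟩)) - curl W Z (x, ⟨(μ, ν), hμν⟩)‖ ≤ Λ₂ * (((L : ℝ)⁻¹) ^ k) ^ 3)
    (hfit₁ : γ * (θ ^ k) ^ 2 ≤ l₁ * N) (hfit₂ : γ * (θ ^ k) ^ 2 ≤ l₂ * N) :
    ‖((hol (vary W Z 1) z (plaqWord μ ν) : (Matrix n n ℂ)ˣ) : Matrix n n ℂ)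
        - ((hol W z (plaqWord μ ν) : (Matrix n n ℂ)ˣ) : Matrix n n ℂ)‖
      ≤ (8 * l₂ ^ 2 * γ + 1536 * l₁ ^ 4 * γ ^ 2 * Real.exp (8 * l₁ ^ 2 * γ)) * θ ^ (14 * k) := by
  obtain ⟨-, hs1⟩ := scale_le_half hL hθ hθ6 hk
  set s : ℝ := θ ^ k with hsdef
  have hs : 0 < s := pow_pos hθ k
  set α : ℝ := 8 * l₁ ^ 2 * γ * θ ^ (8 * k) with hαdef
  have hsup : ∀ x κ, ‖Z x κ‖ ≤ α := fun x κ =>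
    norm_dir_le_rate_cov hL hN hk hθ hθ6 hWu hWP hZP hγ hl₁ hΛl₁ hE hlipc hfit₁ x κ
  have hcurl : ‖curlAt W Z z μ ν‖ ≤ 8 * l₂ ^ 2 * γ * θ ^ (14 * k) :=
    norm_curl_le_rate_cov hL hN hk hθ hθ6 hWu hWP hZP hγ hl₂ hΛl₂ hE ⟨(μ, ν), hμν⟩ hlipc' hfit₂ z
  have h0 := norm_hol_vary_sub_hol_le_curl hWu hZs hsup (t := (1 : ℝ)) zero_le_one z μ ν
  rw [one_mul, one_mul] at h0
  have e8 : θ ^ (8 * k) = s ^ 8 := by rw [hsdef, ← pow_mul, mul_comm k 8]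
  have e14 : θ ^ (14 * k) = s ^ 14 := by rw [hsdef, ← pow_mul, mul_comm k 14]
  have hα0 : 0 ≤ α := by positivity
  have hαs : α = 8 * l₁ ^ 2 * γ * s ^ 8 := by rw [hαdef, e8]
  have hs8 : s ^ 8 ≤ 1 := pow_le_one₀ hs.le hs1
  have hαle : α ≤ 8 * l₁ ^ 2 * γ := by
    rw [hαs]
    have : 8 * l₁ ^ 2 * γ * s ^ 8 ≤ 8 * l₁ ^ 2 * γ * 1 := mul_le_mul_of_nonneg_left hs8 (by positivity)
    linarith
  have hexp1 : Real.exp α - 1 ≤ α * Real.exp α := by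
    have h := Real.add_one_le_exp (-α)
    have h1 : Real.exp α * Real.exp (-α) = 1 := by rw [← Real.exp_add, add_neg_cancel, Real.exp_zero]
    nlinarith [mul_le_mul_of_nonneg_left h (Real.exp_pos α).le, Real.exp_pos α]
  have hexp : Real.exp α - 1 ≤ α * Real.exp (8 * l₁ ^ 2 * γ) :=
    hexp1.trans (mul_le_mul_of_nonneg_left (Real.exp_le_exp.mpr hαle) hα0)
  have hL1 : bondL1At Z z μ ν ≤ 4 * α := by
    unfold bondL1At
    have := hsup z μ; have := hsup (z + e μ) ν; have := hsup (z + e ν) μ; have := hsup z ν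
    linarith
  have hL10 : 0 ≤ bondL1At Z z μ ν := bondL1At_nonneg Z z μ ν
  have h2 : 6 * (Real.exp α - 1) * bondL1At Z z μ ν ≤ 6 * (α * Real.exp (8 * l₁ ^ 2 * γ)) * (4 * α) :=
    mul_le_mul (mul_le_mul_of_nonneg_left hexp (by norm_num)) hL1 hL10 (by positivity)
  have hs16 : s ^ 16 ≤ s ^ 14 := pow_le_pow_of_le_one hs.le hs1 (by norm_num)
  have h3 : 6 * (α * Real.exp (8 * l₁ ^ 2 * γ)) * (4 * α) ≤ 1536 * l₁ ^ 4 * γ ^ 2 * Real.exp (8 * l₁ ^ 2 * γ) * s ^ 14 := by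
    rw [hαs]
    have e1 : 6 * (8 * l₁ ^ 2 * γ * s ^ 8 * Real.exp (8 * l₁ ^ 2 * γ)) * (4 * (8 * l₁ ^ 2 * γ * s ^ 8))
        = 1536 * l₁ ^ 4 * γ ^ 2 * Real.exp (8 * l₁ ^ 2 * γ) * s ^ 16 := by ring
    rw [e1]
    exact mul_le_mul_of_nonneg_left hs16 (by positivity)
  calc ‖((hol (vary W Z 1) z (plaqWord μ ν) : (Matrix n n ℂ)ˣ) : Matrix n n ℂ)
          - ((hol W z (plaqWord μ ν) : (Matrix n n ℂ)ˣ) : Matrix n n ℂ)‖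
        ≤ ‖curlAt W Z z μ ν‖ + 6 * (Real.exp α - 1) * bondL1At Z z μ ν := h0
    _ ≤ 8 * l₂ ^ 2 * γ * θ ^ (14 * k) + 1536 * l₁ ^ 4 * γ ^ 2 * Real.exp (8 * l₁ ^ 2 * γ) * s ^ 14 :=
        add_le_add hcurl (h2.trans h3)
    _ = (8 * l₂ ^ 2 * γ + 1536 * l₁ ^ 4 * γ ^ 2 * Real.exp (8 * l₁ ^ 2 * γ)) * θ ^ (14 * k) := by rw [e14]; ring

/-! ## §2 Through row NE3's root T-E_w with COVARIANT antecedents — the gauge-invariant form of the ask -/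

/-- **THE FOUR COORDINATES AT GEOMETRIC RATE, THROUGH T-E_w, COVARIANT ANTECEDENTS** (module docstring; the one-run facts
«`W = rescale L (bavg L UB)` unitary and `N L^k`-periodic» displayed). [folklore] -/
theorem closeness_rates_cov_of_ne3EnergyRateW [Nonempty n] {𝒞 : ℕ → Set (Site 4 → Fin 4 → (Matrix n n ℂ)ˣ)} {L N : ℕ}
    (hL : 2 ≤ L) (hN : 1 ≤ N) {θ : ℝ} (hθ : 0 < θ) (hθ6 : θ ^ 6 = ((L : ℝ))⁻¹) {b g C : ℝ} (hg : 0 ≤ g) (hC : 0 ≤ C)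
    {dom : Set (Site 4 → Fin 4 → (Matrix n n ℂ)ˣ)} (h : NE3EnergyRateW 4 𝒞 L N b g C dom) {γ : ℝ} (hγ : 0 < γ)
    (hγ3 : C * (wallConst 4 L * (N : ℝ) ^ 2 * (Real.sqrt g * dualC2 4 L + 2 * b ^ 2 * dualC1 4 L)) ≤ γ ^ 3)
    {k : ℕ} (hk : 1 ≤ k) {V : Site 4 → Fin 4 → (Matrix n n ℂ)ˣ} (hV : V ∈ dom)
    {UA UB : Site 4 → Fin 4 → (Matrix n n ℂ)ˣ} (hA : IsMinimiser 4 𝒞 L N k V UA) (hB : IsMinimiser 4 𝒞 L N (k + 1) V UB)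
    (hreg : Regular 4 L N b g (k + 1) UB) (hWu : IsUnitaryCfg (rescale L (bavg L UB)))
    (hWP : IsPeriodicCfg (rescale L (bavg L UB)) ((N * L ^ k : ℕ) : ℤ)) :
    ∃ (u : Site 4 → (Matrix n n ℂ)ˣ) (Z : Site 4 → Fin 4 → Matrix n n ℂ),
      IsUnitarySite u ∧ IsPeriodicSite u ((N * L ^ k : ℕ) : ℤ) ∧ IsSkewDir Z ∧ IsPeriodicDir Z ((N * L ^ k : ℕ) : ℤ) ∧
      gaugeAct u UA = vary (rescale L (bavg L UB)) Z 1 ∧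
      -- (P) + (Gᶜ): potential and COVARIANT gradient, from (Lip₁ᶜ) + (Lip₂′ᶜ) + FIT(l₁)
      (∀ (Λ₁ l₁ Λ₂' : ℝ), 0 < l₁ → Λ₁ ≤ l₁ ^ 3 → 0 < Λ₂' →
        (∀ (κ : Fin 4) (x : Site 4) (μ : Fin 4),
          ‖Ad (rescale L (bavg L UB) (x + e κ) μ) (Z (x + e μ) κ) - Z x κ‖ ≤ Λ₁ * (((L : ℝ)⁻¹) ^ k) ^ 2) →
        (∀ (κ μ : Fin 4) (y : Site 4),
          ‖Ad (rescale L (bavg L UB) (y + e κ) μ)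
              (Ad (rescale L (bavg L UB) (y + e κ + e μ) μ) (Z (y + (2 : ℕ) • e μ) κ) - Z (y + e μ) κ)
            - (Ad (rescale L (bavg L UB) (y + e κ) μ) (Z (y + e μ) κ) - Z y κ)‖ ≤ Λ₂' * (((L : ℝ)⁻¹) ^ k) ^ 3) →
        γ * (θ ^ k) ^ 2 ≤ l₁ * N →
          (∀ (x : Site 4) (κ : Fin 4), ‖Z x κ‖ ≤ 8 * l₁ ^ 2 * γ * θ ^ (8 * k)) ∧
          (∀ (x : Site 4) (μ κ : Fin 4),
            ‖Ad (rescale L (bavg L UB) (x + e κ) μ) (Z (x + e μ) κ) - Z x κ‖ ≤ 4 * l₁ * Real.sqrt (2 * γ * Λ₂') * θ ^ (13 * k))) ∧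
      -- (C) + (Q): curl and plaquette on the plane μ < ν, from (Lip₁ᶜ) + (Lip₂ᶜ) + both FITs
      (∀ (μ ν : Fin 4) (hμν : μ < ν) (Λ₁ l₁ Λ₂ l₂ : ℝ), 0 < l₁ → Λ₁ ≤ l₁ ^ 3 → 0 < l₂ → Λ₂ ≤ l₂ ^ 3 →
        (∀ (κ : Fin 4) (x : Site 4) (ρ : Fin 4),
          ‖Ad (rescale L (bavg L UB) (x + e κ) ρ) (Z (x + e ρ) κ) - Z x κ‖ ≤ Λ₁ * (((L : ℝ)⁻¹) ^ k) ^ 2) →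
        (∀ (x : Site 4) (ρ : Fin 4),
          ‖Ad (rescale L (bavg L UB) x ρ) (curl (rescale L (bavg L UB)) Z (x + e ρ, ⟨(μ, ν), hμν⟩))
              - curl (rescale L (bavg L UB)) Z (x, ⟨(μ, ν), hμν⟩)‖ ≤ Λ₂ * (((L : ℝ)⁻¹) ^ k) ^ 3) →
        γ * (θ ^ k) ^ 2 ≤ l₁ * N → γ * (θ ^ k) ^ 2 ≤ l₂ * N →
          (∀ x : Site 4, ‖curl (rescale L (bavg L UB)) Z (x, ⟨(μ, ν), hμν⟩)‖ ≤ 8 * l₂ ^ 2 * γ * θ ^ (14 * k)) ∧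
          (∀ z : Site 4,
            ‖((hol (gaugeAct u UA) z (plaqWord μ ν) : (Matrix n n ℂ)ˣ) : Matrix n n ℂ)
                - ((hol (rescale L (bavg L UB)) z (plaqWord μ ν) : (Matrix n n ℂ)ˣ) : Matrix n n ℂ)‖
              ≤ (8 * l₂ ^ 2 * γ + 1536 * l₁ ^ 4 * γ ^ 2 * Real.exp (8 * l₁ ^ 2 * γ)) * θ ^ (14 * k))) := by
  obtain ⟨u, Z, hu, huP, hZ, hZP, hrep, hE⟩ := h k hk V hV UA UB hA hB hreg
  have hL1 : 1 ≤ L := by omega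
  have hEγ : (L : ℝ) ^ k * energyNormW L k (rescale L (bavg L UB)) Z (periodBox (d := 4) (N * L ^ k)) ≤ γ ^ 3 :=
    (energy_budget_of_residualScale hL1 N b hg hC k hE).trans hγ3
  refine ⟨u, Z, hu, huP, hZ, hZP, hrep, ?_, ?_⟩
  · intro Λ₁ l₁ Λ₂' hl₁ hΛl hΛ₂' hlipc hlip2c hfit
    exact ⟨fun x κ => norm_dir_le_rate_cov hL hN hk hθ hθ6 hWu hWP hZP hγ hl₁ hΛl hEγ hlipc hfit x κ,
      fun x μ κ => norm_covDiff_le_rate hL hN hk hθ hθ6 hWu hWP hZP hγ hl₁ hΛl hΛ₂' hEγ hlipc hlip2c hfit x μ κ⟩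
  · intro μ ν hμν Λ₁ l₁ Λ₂ l₂ hl₁ hΛl₁ hl₂ hΛl₂ hlipc hlipc' hfit₁ hfit₂
    refine ⟨fun x => norm_curl_le_rate_cov hL hN hk hθ hθ6 hWu hWP hZP hγ hl₂ hΛl₂ hEγ ⟨(μ, ν), hμν⟩ hlipc' hfit₂ x,
      fun z => ?_⟩
    rw [hrep]
    exact norm_hol_sub_le_rate_cov hL hN hk hθ hθ6 hWu hZ hWP hZP hγ hl₁ hΛl₁ hl₂ hΛl₂ hEγ hlipc z hμν hlipc' hfit₁ hfit₂

end

end Summit.QuantumFields.BalabanUV.T4Continuum.NE7EtaRatesD4Cov
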